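import Literature.Geometry.Symplectic.GirouxContactPathTube
import Literature.Geometry.Symplectic.GrayStabilityLinear
import Literature.Geometry.Manifold.SmoothEmbeddingInverse
import Mathlib.Analysis.Calculus.Deriv.Slope
import HarnessLib

/-!
# Binding tubes of an open book: injective differential, the core frame in the disc
# coordinate, and two first-order lemmas along rays

Topic `Literature/Geometry/Symplectic`; an API file (everything PROVED, no definitions, no named
facts) for the open books `OpenBook M` of `PlanarContactBoundary.lean` and the tube calculus of
`GirouxContactPathTube.lean` (`param i`, `qmap i`).  It is the groundwork of
`OpenBookGirouxFormTransfer.lean` (a Giroux form sees an open book only through `(B, π)`):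

* `fderiv_apply_eq_zero_of_eventually_eq_zero`, `fderiv_apply_direction_of_eventually` — for a
  map `Q` differentiable at `p`: if `Q` vanishes along the line `p + t v` then `dQ(v) = 0`; if
  `Q p = 0` and `Q (p + t v)` is a non-negative multiple of a fixed vector `w` for small `t > 0`,
  then so is `dQ(v)` (first-order Taylor expansion along the ray);
* `GrayMoser.det3_smul_eq` (Cramer's rule in `ℝ³`), `GrayMoser.det3_frame_change`,
  `GrayMoser.eq_frame_of_apply` (coordinates of a vector in a frame `(b, e₁, e₂)` read through a
  linear map `D : ℝ³ → ℝ²` killing exactly `ℝ b`);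
* `OpenBook.injective_mfderiv_tube` — the differential of a binding tube `𝕊¹ × ℝ² → M` is
  injective (its inverse is smooth on the open image,
  `Literature.Geometry.Manifold.contMDiffOn_invFun_range`); hence `OpenBook.coreTangent_ne_zero`
  and `OpenBook.discFrame_ne_smul_coreTangent`;
* `OpenBook.mfderiv_qmap_coreTangent`, `OpenBook.mfderiv_qmap_discFrame_zero`,
  `OpenBook.mfderiv_qmap_discFrame_one` — the disc coordinate `qmap i` (`tube i (x, w) ↦ w`)
  has differential `0`, `(1, 0)`, `(0, 1)` on the core frame `(∂_x tube, ∂_{w₁} tube, ∂_{w₂} tube)`;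
* `angularDeriv_congr_of_eventuallyEq`, `OpenBook.angularDeriv_eq_of_eqOn` — the angular
  differential `dθ` of the fibration is local in `π`.

## References

* J. B. Etnyre, *Lectures on open book decompositions and contact structures*, Clay Math. Proc.
  5 (2006), Def. 2.1 (open books), proof of Lemma 3.3 (coordinates near the binding). [Etnyre2006]
* J. M. Lee, *Introduction to Smooth Manifolds* (2013), Prop. 4.22. [LeeSmoothManifolds2013]
-/

noncomputable section

open scoped Manifold ContDiff Topology
open Set Function Filter
open Literature.Geometry.Kaehler Literature.Topology.FourManifolds

namespace Literature.Geometry.Symplectic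

universe u

/-! ### Two first-order facts about a differentiable map along a ray -/

section Ray

variable {E F : Type*} [NormedAddCommGroup E] [NormedSpace ℝ E] [NormedAddCommGroup F]
  [NormedSpace ℝ F]

/-- If `Q` is differentiable at `p` and vanishes along the line `t ↦ p + t v` near `t = 0`, then
`dQ_p(v) = 0`. [folklore] -/
theorem fderiv_apply_eq_zero_of_eventually_eq_zero {Q : E → F} {L : E →L[ℝ] F} {p v : E}
    (hQ : HasFDerivAt Q L p) (h : ∀ᶠ t in 𝓝 (0 : ℝ), Q (p + t • v) = 0) : L v = 0 := by
  have hline : HasDerivAt (fun t : ℝ => p + t • v) v 0 := by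
    simpa using ((hasDerivAt_id (0 : ℝ)).smul_const v).const_add p
  have h1 : HasDerivAt (fun t : ℝ => Q (p + t • v)) (L v) 0 := by
    have hQ' : HasFDerivAt Q L (p + (0 : ℝ) • v) := by simpa using hQ
    exact hQ'.comp_hasDerivAt (0 : ℝ) hline
  have h2 : HasDerivAt (fun t : ℝ => Q (p + t • v)) 0 0 :=
    (hasDerivAt_const (0 : ℝ) (0 : F)).congr_of_eventuallyEq h
  exact h1.unique h2

/-- **Direction-preserving maps have direction-preserving differential.**  If `Q` is
differentiable at `p` with `Q p = 0` and, for small `t > 0`, `Q (p + t v)` is a non-negative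
multiple of the fixed vector `w` in the normalised form `‖w‖ · Q(p + t v) = ‖Q(p + t v)‖ · w`,
then `‖w‖ · dQ_p(v) = ‖dQ_p(v)‖ · w` (divide by `t` and let `t → 0⁺`). [folklore] -/
theorem fderiv_apply_direction_of_eventually {Q : E → F} {L : E →L[ℝ] F} {p v : E} {w : F}
    (hQ : HasFDerivAt Q L p) (hp : Q p = 0)
    (h : ∀ᶠ t in 𝓝[>] (0 : ℝ), ‖w‖ • Q (p + t • v) = ‖Q (p + t • v)‖ • w) :
    ‖w‖ • L v = ‖L v‖ • w := by
  have hline : HasDerivAt (fun t : ℝ => p + t • v) v 0 := by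
    simpa using ((hasDerivAt_id (0 : ℝ)).smul_const v).const_add p
  have h1 : HasDerivAt (fun t : ℝ => Q (p + t • v)) (L v) 0 := by
    have hQ' : HasFDerivAt Q L (p + (0 : ℝ) • v) := by simpa using hQ
    exact hQ'.comp_hasDerivAt (0 : ℝ) hline
  -- the difference quotient `g t = t⁻¹ Q(p + t v)` tends to `L v` as `t → 0⁺`
  have hg : Tendsto (fun t : ℝ => t⁻¹ • Q (p + t • v)) (𝓝[>] 0) (𝓝 (L v)) := by
    have := h1.tendsto_slope_zero_right
    simpa [hp] using this
  -- and satisfies `‖w‖ g t = ‖g t‖ w` for small `t > 0`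
  have hev : ∀ᶠ t in 𝓝[>] (0 : ℝ),
      ‖w‖ • (t⁻¹ • Q (p + t • v)) = ‖t⁻¹ • Q (p + t • v)‖ • w := by
    filter_upwards [h, self_mem_nhdsWithin] with t ht ht0
    have ht0' : (0 : ℝ) < t := ht0
    rw [smul_comm, ht, norm_smul, Real.norm_eq_abs, abs_of_pos (inv_pos.2 ht0'), smul_smul]
  have hl : Tendsto (fun t : ℝ => ‖w‖ • (t⁻¹ • Q (p + t • v))) (𝓝[>] 0)
      (𝓝 (‖w‖ • L v)) :=
    hg.const_smul ‖w‖
  have hr : Tendsto (fun t : ℝ => ‖t⁻¹ • Q (p + t • v)‖ • w) (𝓝[>] 0)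
      (𝓝 (‖L v‖ • w)) :=
    hg.norm.smul_const w
  exact tendsto_nhds_unique_of_eventuallyEq hl hr hev

end Ray

/-! ### Linear algebra in `ℝ³`: Cramer's rule for `det3` and frames along a line -/

namespace GrayMoser

/-- **Cramer's rule** in `ℝ³`:
`det(b, e₁, e₂) v = det(v, e₁, e₂) b + det(b, v, e₂) e₁ + det(b, e₁, v) e₂`. [folklore] -/
theorem det3_smul_eq (b e₁ e₂ v : EuclideanSpace ℝ (Fin 3)) :
    det3 b e₁ e₂ • v = det3 v e₁ e₂ • b + det3 b v e₂ • e₁ + det3 b e₁ v • e₂ := by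
  ext i
  fin_cases i <;> simp [det3] <;> ring

/-- **Change of frame along the line `ℝ b`**: replacing `b` by `a b` and adding multiples of `b`
to `e₁`, `e₂` while rescaling them (with a possible shear between them) multiplies the
determinant by `a (μ₁ μ₂ - ν₁ ν₂)`. [folklore] -/
theorem det3_frame_change (b e₁ e₂ : EuclideanSpace ℝ (Fin 3)) (a c₁ c₂ μ₁ μ₂ ν₁ ν₂ : ℝ) :
    det3 (a • b) (c₁ • b + μ₁ • e₁ + ν₁ • e₂) (c₂ • b + ν₂ • e₁ + μ₂ • e₂) =
      a * (μ₁ * μ₂ - ν₁ * ν₂) * det3 b e₁ e₂ := by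
  simp [det3]
  ring

/-- **Coordinates in a frame read through a linear map killing its first vector.**  If
`D : ℝ³ → ℝ²` is linear with `D b = 0`, `D e₁ = (1, 0)`, `D e₂ = (0, 1)` and `det(b, e₁, e₂) ≠ 0`,
then every `v` is `v = (det(v, e₁, e₂) / det(b, e₁, e₂)) b + (D v)₀ e₁ + (D v)₁ e₂`; in
particular `ker D = ℝ b`. [folklore] -/
theorem eq_frame_of_apply (D : EuclideanSpace ℝ (Fin 3) →L[ℝ] EuclideanSpace ℝ (Fin 2))
    {b e₁ e₂ : EuclideanSpace ℝ (Fin 3)} (hb : D b = 0) (h₁ : D e₁ = EuclideanSpace.single 0 1)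
    (h₂ : D e₂ = EuclideanSpace.single 1 1) (hdet : det3 b e₁ e₂ ≠ 0)
    (v : EuclideanSpace ℝ (Fin 3)) :
    v = (det3 v e₁ e₂ / det3 b e₁ e₂) • b + (D v) 0 • e₁ + (D v) 1 • e₂ := by
  have hc := det3_smul_eq b e₁ e₂ v
  have hD : det3 b e₁ e₂ • D v =
      det3 b v e₂ • EuclideanSpace.single 0 1 + det3 b e₁ v • EuclideanSpace.single 1 1 := by
    have := congrArg D hc
    simpa [map_add, map_smul, hb, h₁, h₂] using this
  have h0 : det3 b e₁ e₂ * D v 0 = det3 b v e₂ := by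
    have := congrArg (fun z : EuclideanSpace ℝ (Fin 2) => z 0) hD
    simpa using this
  have h1 : det3 b e₁ e₂ * D v 1 = det3 b e₁ v := by
    have := congrArg (fun z : EuclideanSpace ℝ (Fin 2) => z 1) hD
    simpa using this
  have key : det3 b e₁ e₂ • v =
      det3 b e₁ e₂ • ((det3 v e₁ e₂ / det3 b e₁ e₂) • b + (D v) 0 • e₁ + (D v) 1 • e₂) := by
    rw [smul_add, smul_add, smul_smul, smul_smul, smul_smul, mul_div_cancel₀ _ hdet, h0, h1]
    exact hc
  exact smul_right_injective _ hdet key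

end GrayMoser

/-! ### The binding tubes of an open book -/

variable {M : Type u} [TopologicalSpace M] [ChartedSpace (EuclideanSpace ℝ (Fin 3)) M]
  [IsManifold (𝓡 3) ∞ M]

namespace OpenBook

/-- **The differential of a binding tube `tube i : 𝕊¹ × ℝ² → M` is injective at every point**
(the tube is a smooth embedding with open image, so its inverse is smooth on the image,
`Literature.Geometry.Manifold.contMDiffOn_invFun_range`, and `d(tube⁻¹) ∘ d(tube) = id`).
[cite: LeeSmoothManifolds2013, Prop. 4.22] -/
theorem injective_mfderiv_tube (ob : OpenBook M) (i : Fin ob.k)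
    (q : (Metric.sphere (0 : EuclideanSpace ℝ (Fin 2)) 1) × EuclideanSpace ℝ (Fin 2)) :
    Injective (mfderiv ((𝓡 1).prod 𝓘(ℝ, EuclideanSpace ℝ (Fin 2))) (𝓡 3) (ob.tube i) q) := by
  haveI : Nonempty ((Metric.sphere (0 : EuclideanSpace ℝ (Fin 2)) 1) × EuclideanSpace ℝ (Fin 2)) :=
    ⟨q⟩
  set g : M → (Metric.sphere (0 : EuclideanSpace ℝ (Fin 2)) 1) × EuclideanSpace ℝ (Fin 2) :=
    invFun (ob.tube i) with hg
  have hgs : ContMDiffAt (𝓡 3) ((𝓡 1).prod 𝓘(ℝ, EuclideanSpace ℝ (Fin 2))) ∞ g (ob.tube i q) :=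
    (Literature.Geometry.Manifold.contMDiffOn_invFun_range
      (ob.isSmoothEmbedding_tube i)).contMDiffAt ((ob.isOpen_range_tube i).mem_nhds ⟨q, rfl⟩)
  have hts : ContMDiffAt ((𝓡 1).prod 𝓘(ℝ, EuclideanSpace ℝ (Fin 2))) (𝓡 3) ∞ (ob.tube i) q :=
    (ob.isSmoothEmbedding_tube i).contMDiff q
  have hcomp : g ∘ ob.tube i = id := funext fun z => leftInverse_invFun (ob.injective_tube i) z
  have hchain :=
    mfderiv_comp q (hgs.mdifferentiableAt (by simp)) (hts.mdifferentiableAt (by simp))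
  rw [hcomp, mfderiv_id] at hchain
  have hleft : ∀ z : TangentSpace ((𝓡 1).prod 𝓘(ℝ, EuclideanSpace ℝ (Fin 2))) q,
      mfderiv (𝓡 3) ((𝓡 1).prod 𝓘(ℝ, EuclideanSpace ℝ (Fin 2))) g (ob.tube i q)
        (mfderiv ((𝓡 1).prod 𝓘(ℝ, EuclideanSpace ℝ (Fin 2))) (𝓡 3) (ob.tube i) q z) = z :=
    fun z => (DFunLike.congr_fun hchain z).symm
  intro v w hvw
  have h := congrArg
    (mfderiv (𝓡 3) ((𝓡 1).prod 𝓘(ℝ, EuclideanSpace ℝ (Fin 2))) g (ob.tube i q)) hvw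
  rwa [hleft, hleft] at h

/-- The tangent vector `b = ∂_x tube` of a binding component is non-zero. [folklore] -/
theorem coreTangent_ne_zero (ob : OpenBook M) (i : Fin ob.k)
    (x : Metric.sphere (0 : EuclideanSpace ℝ (Fin 2)) 1) : ob.coreTangent i x ≠ 0 := by
  intro h
  have h0 : mfderiv ((𝓡 1).prod 𝓘(ℝ, EuclideanSpace ℝ (Fin 2))) (𝓡 3) (ob.tube i) (x, 0)
      (EuclideanSpace.single (0 : Fin 1) (1 : ℝ), 0) =
      mfderiv ((𝓡 1).prod 𝓘(ℝ, EuclideanSpace ℝ (Fin 2))) (𝓡 3) (ob.tube i) (x, 0) 0 := by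
    rw [map_zero]; exact h
  have h2 : ((EuclideanSpace.single (0 : Fin 1) (1 : ℝ), (0 : EuclideanSpace ℝ (Fin 2))) :
      EuclideanSpace ℝ (Fin 1) × EuclideanSpace ℝ (Fin 2)) = 0 :=
    ob.injective_mfderiv_tube i (x, 0) h0
  have h3 : EuclideanSpace.single (0 : Fin 1) (1 : ℝ) = (0 : EuclideanSpace ℝ (Fin 1)) :=
    congrArg Prod.fst h2
  have h4 := congrArg (fun z : EuclideanSpace ℝ (Fin 1) => z 0) h3
  simp at h4

/-- **The meridional frame vectors `eⱼ = ∂_{wⱼ} tube` are not tangent to the binding**: `eⱼ` is no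
multiple of `b = ∂_x tube`. [folklore] -/
theorem discFrame_ne_smul_coreTangent (ob : OpenBook M) (i : Fin ob.k)
    (x : Metric.sphere (0 : EuclideanSpace ℝ (Fin 2)) 1) (j : Fin 2) (c : ℝ) :
    ob.discFrame i x j ≠ c • ob.coreTangent i x := by
  intro h1
  have key : mfderiv ((𝓡 1).prod 𝓘(ℝ, EuclideanSpace ℝ (Fin 2))) (𝓡 3) (ob.tube i) (x, 0)
      (c • ((EuclideanSpace.single (0 : Fin 1) (1 : ℝ), (0 : EuclideanSpace ℝ (Fin 2))) :
        EuclideanSpace ℝ (Fin 1) × EuclideanSpace ℝ (Fin 2))) = c • ob.coreTangent i x :=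
    ContinuousLinearMap.map_smul _ _ _
  have h2 : (((0 : EuclideanSpace ℝ (Fin 1)), EuclideanSpace.single j (1 : ℝ)) :
      EuclideanSpace ℝ (Fin 1) × EuclideanSpace ℝ (Fin 2)) =
      c • ((EuclideanSpace.single (0 : Fin 1) (1 : ℝ), (0 : EuclideanSpace ℝ (Fin 2))) :
        EuclideanSpace ℝ (Fin 1) × EuclideanSpace ℝ (Fin 2)) :=
    ob.injective_mfderiv_tube i (x, 0) (h1.trans key.symm)
  have h3 := congrArg (fun z : EuclideanSpace ℝ (Fin 1) × EuclideanSpace ℝ (Fin 2) => z.2 j) h2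
  simp at h3

/-- **The disc coordinate kills the binding direction**: `d(qmap i)(b) = 0` at the core point
`tube i (e^{iθ}, 0)`, `b = ∂_x tube` (from `qmap ∘ param = πw` and `d(param) e₀ = c b`, `c ≠ 0`).
[cite: Etnyre2006, proof of Lemma 3.3] -/
theorem mfderiv_qmap_coreTangent (ob : OpenBook M) (i : Fin ob.k) (θ : ℝ) :
    mfderiv (𝓡 3) 𝓘(ℝ, EuclideanSpace ℝ (Fin 2)) (ob.qmap i) (ob.tube i (circlePoint θ, 0))
      (ob.coreTangent i (circlePoint θ)) = 0 := by
  have h1 := ob.mfderiv_qmap_comp_param i (mk3 θ 0) (stdBasis3 0)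
  rw [ob.mfderiv_param_stdBasis3_zero i, mk3_apply_zero, πw_mk3, psiTangent_zero,
    πw_stdBasis3_zero] at h1
  rw [param_mk3] at h1
  set D : EuclideanSpace ℝ (Fin 3) →L[ℝ] EuclideanSpace ℝ (Fin 2) :=
    mfderiv (𝓡 3) 𝓘(ℝ, EuclideanSpace ℝ (Fin 2)) (ob.qmap i) (ob.tube i (circlePoint θ, 0)) with hD
  have h2 : D (circleSpeed θ • ob.coreTangent i (circlePoint θ)) = 0 := h1
  rw [map_smul] at h2
  exact (smul_eq_zero.1 h2).resolve_left (circleSpeed_ne_zero θ)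

/-- **The disc coordinate on the meridional frame, I**: `d(qmap i)(e₁) = (1, 0)` at the core
point `tube i (e^{iθ}, 0)`, `e₁ = ∂_{w₁} tube`. [cite: Etnyre2006, proof of Lemma 3.3] -/
theorem mfderiv_qmap_discFrame_zero (ob : OpenBook M) (i : Fin ob.k) (θ : ℝ) :
    mfderiv (𝓡 3) 𝓘(ℝ, EuclideanSpace ℝ (Fin 2)) (ob.qmap i) (ob.tube i (circlePoint θ, 0))
      (ob.discFrame i (circlePoint θ) 0) = EuclideanSpace.single 0 1 := by
  have h1 := ob.mfderiv_qmap_comp_param i (mk3 θ 0) (stdBasis3 1)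
  rw [ob.mfderiv_param_stdBasis3_one i, mk3_apply_zero, πw_mk3, wTangent_zero,
    πw_stdBasis3_one] at h1
  rwa [param_mk3] at h1

/-- **The disc coordinate on the meridional frame, II**: `d(qmap i)(e₂) = (0, 1)` at the core
point `tube i (e^{iθ}, 0)`, `e₂ = ∂_{w₂} tube`. [cite: Etnyre2006, proof of Lemma 3.3] -/
theorem mfderiv_qmap_discFrame_one (ob : OpenBook M) (i : Fin ob.k) (θ : ℝ) :
    mfderiv (𝓡 3) 𝓘(ℝ, EuclideanSpace ℝ (Fin 2)) (ob.qmap i) (ob.tube i (circlePoint θ, 0))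
      (ob.discFrame i (circlePoint θ) 1) = EuclideanSpace.single 1 1 := by
  have h1 := ob.mfderiv_qmap_comp_param i (mk3 θ 0) (stdBasis3 2)
  rw [ob.mfderiv_param_stdBasis3_two i, mk3_apply_zero, πw_mk3, wTangent_zero,
    πw_stdBasis3_two] at h1
  rwa [param_mk3] at h1

end OpenBook

/-! ### `dθ` is local in `π` -/

omit [IsManifold (𝓡 3) ∞ M] in
/-- **`dθ` is local in `π`**: if two maps to the circle agree near `y`, their angular
differentials at `y` agree. [folklore] -/
theorem angularDeriv_congr_of_eventuallyEq
    {θ θ' : M → Metric.sphere (0 : EuclideanSpace ℝ (Fin 2)) 1} {y : M} (h : θ' =ᶠ[𝓝 y] θ) :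
    angularDeriv θ' y = angularDeriv θ y := by
  have h0 : θ' y = θ y := h.self_of_nhds
  have h1 : (fun z => (θ' z : EuclideanSpace ℝ (Fin 2))) =ᶠ[𝓝 y]
      fun z => (θ z : EuclideanSpace ℝ (Fin 2)) :=
    h.mono fun z hz =>
      congrArg (fun t : Metric.sphere (0 : EuclideanSpace ℝ (Fin 2)) 1 =>
        (t : EuclideanSpace ℝ (Fin 2))) hz
  unfold angularDeriv
  rw [h1.mfderiv_eq, h0]

/-- Two open books with the same fibration off the binding of the first have the same angular
differential off that binding. [folklore] -/
theorem OpenBook.angularDeriv_eq_of_eqOn [T2Space M] {ob ob' : OpenBook M}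
    (hπ : ∀ y, y ∉ ob.binding → ob'.proj y = ob.proj y) {y : M} (hy : y ∉ ob.binding) :
    angularDeriv ob'.proj y = angularDeriv ob.proj y :=
  angularDeriv_congr_of_eventuallyEq (Filter.eventuallyEq_of_mem
    (ob.isOpen_compl_binding.mem_nhds hy) fun z hz => hπ z hz)

end Literature.Geometry.Symplectic
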